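import Literature.MathematicalPhysics.QuantumFieldTheory.BalabanImbrieJaffe1984to88.BIJ88ClusterSupports312
import Literature.MathematicalPhysics.QuantumFieldTheory.BalabanImbrieJaffe1984to88.BIJ88SupportRegrouping312

/-!
# `BalabanImbrieJaffe1984to88.BIJ88ObservableFactorization312` — T. Bałaban, J. Imbrie, A. Jaffe, *Effective action and cluster properties
of the abelian Higgs model*, Commun. Math. Phys. **114** (1988) 257–315 [BalabanImbrieJaffe1988]: Sect. 5.14, p. 312 [PDF 56] — **the second
display of p. 312 DERIVED** at the level of the observable-carrying polymer gas, with the remainder activities **`G_k(X_{r′})` DEFINED**: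
*"Without going into details, it is clear that the result can be written in the following form: ⟨Π_{σ₁} F^{m̄}_{k,loc}(X_{σ₁})⟩₁ =
Σ_{{X_{r′}}} Π_{r′} G_k(X_{r′}) Π_{c: X_c⊄∪_{r′}X_{r′}} F^L_{k+1,loc}(X_c). The X_{r′} are disjoint, and each one covers at least one X_{σ₁}"*.

HONEST FRAMING (cell `lit-balaban`, verbatim): statement-level skeleton of published theorems with citation tags; proofs where landed; nothing here is a claim about the Yang–Mills mass gap.

PDF held: `paper:balaban1988-cmp114-bij-abelian-higgs-effective-action` (journal page = PDF page + 256); p. 309/310 = PDF p. 53/54, p. 312 = PDF p. 56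
(renders `renders/original-p053…p056-x2.png` in the seat folder).

CITATION HEADER (verbatim).  p. 312 [PDF 56]: *"Having extracted the desired perturbative terms F^L_{k+1,loc}(X_c), we need to finish the calculation
of the remainders by giving a cluster expansion for ⟨Π_r F_{k,rem}(X_r)⟩₁, with appropriate bounds. We use essentially the same expansion as before,
Mayer-expanding V^{(k)}(Y)'s and interpolating the Gaussian measure. Finally the polymer expansion u = 1 + a permits us to factor out the
normalization. Without going into details, it is clear that the result can be written in the following form: ⟨Π_{σ₁} F^{m̄}_{k,loc}(X_{σ₁})⟩₁ =
Σ_{{X_{r′}}} Π_{r′} G_k(X_{r′}) Π_{c: X_c⊄∪_{r′}X_{r′}} F^L_{k+1,loc}(X_c). The X_{r′} are disjoint, and each one covers at least one X_{σ₁}, the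
support of one of the observables F^{m̄}_{k,loc}."*  p. 309 [PDF 53]: *"Each X_γ must cover and connect all the t-derivatives specified by H_γ."*

WHAT IS REPRODUCED (unit `lit-balaban-p25`, generation 11 of the Phase-2 proof seat p25; SKELETON row `C2.Claim@312` (second display) — step 4, the
assembly, on `BIJ88ObservableGas312` (step 1: decorated gas, KP ratio), `BIJ88ClusterSupports312` (step 2: supports, Ψ, Mayer factors `m`) and
`BIJ88SupportRegrouping312` (step 3: regrouping by overlap-components); HOME `run/shared/lean/pub/lit-balaban/lit-balaban-p25/`).
THE MODEL.  Cubes `ι`; vacuum polymers `P` (supports `supp`, activities `w`, incompatibility `inc`, KP volume `Λ` = the polymers of Λ₁₂^{(k)});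
observables `σ` with supports `loc r` (the `X_{σ₁}` resp. the remainder supports `X_r`), the inserted set `Rset`; observable-carrying polymers `Q`
(supports `suppQ`, carried observables `obs X` — *"H_γ ≠ ∅"*, covering convention `hobs`: a carried observable lies in `Rset` and its support inside
the carrier, p. 309 *"Each X_γ must cover … H_γ"*), universe `𝒬`, activities `wQ`; the printed incompatibility *"X, Y overlap"* (`hincQ`).  The
admissible decorated families `decFamilies` = pairwise non-overlapping, carrying every inserted observable exactly once.
§1 the items `Q ⊕ Finset ι` (decorated polymers and Mayer support sets) with supports `isuppO`, the universe `itemU 𝒬 Λ`, the weights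
  `itemWeight = (wQ, m)`; `obsIn` (observables located inside a set of cubes); the LOCAL constraint `AdmLoc` on an overlap-connected set of items
  (its decorated polymers pairwise non-overlapping, every support set overlapping one of them, and the carried observables = the inserted
  observables located inside its support); `Cov` (every inserted observable inside some aggregate); **`Gk`** := `aggWeight` of step 3 for these
  data — THE DEFINITION of `G_k(X_{r′})`: the sum over the overlap-connected admissible sets of decorated polymers and support sets filling `X_{r′}`
  of `Π wQ · Π m`.
§2 `sum_pairs_eq_sum_items` (the step-2 sum over pairs `(D, 𝒴)` = a sum over sets of items), **`globalAdm_iff_local`** (the global admissibility of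
  `(D, 𝒴)` — `D ∈ decFamilies`, every `S ∈ 𝒴` overlapping `D` — is equivalent to `AdmLoc` on every overlap-component plus `Cov` of the component
  supports; uses only the covering convention and the nonemptiness of observable supports).
§3 **`obsRatio_eq_sum_prod_Gk`** — THE SECOND DISPLAY OF p. 312 (remainder-expectation form): in a Kotecký–Preiss volume,
  `obsNumerator(decFamilies)/Z(Λ) = Σ_{ρ ∈ disjFamilies, Cov ρ} Π_{X′∈ρ} G_k(X′)` — the normalized expectation with the observables `Rset` inserted is a
  sum over families of PAIRWISE DISJOINT aggregates covering the observable supports, with factorized, locally defined activities; `Gk_covers`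
  (*"each one covers at least one X_{σ₁}"*: `G_k(X′) = 0` unless some `loc r ⊆ X′`).
HONEST SCOPE / READINGS: (a) the derivation is for the expectation with ALL observables of `Rset` inserted — the printed use is for
⟨Π_r F_{k,rem}(X_r)⟩₁ after the integration by parts of p. 311 (first display of p. 312, typed in `BIJ88Result5145`); the perturbative factors
F^L_{k+1,loc}(X_c) of that first display are constants carried along and are NOT modelled here; (b) inputs = the printed ones: the polymer expansions
(5.13.4)/(5.14.3) in prime-dropped form supply `obsNumerator` and `Z(Λ)` (rows C2.Eq5.13.3-5.13.4, C2.Eq5.14.3-5.14.4), and the KP hypothesis on the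
vacuum activities is p. 310 *"a standard exercise … using (5.14.4)"*; (c) no bound on `G_k` (`BIJ88Sect5StatementsPart4.Ineq312`) is asserted; 0 `sorry`,
0 new `Prop` facts (D-0026).
-/

noncomputable section

open Finset
open Literature.Probability.LatticeModels
open Literature.MathematicalPhysics.QuantumFieldTheory.BalabanImbrieJaffe1984to88.BIJ88ObservableGas312
open Literature.MathematicalPhysics.QuantumFieldTheory.BalabanImbrieJaffe1984to88.BIJ88ClusterSupports312
open Literature.MathematicalPhysics.QuantumFieldTheory.BalabanImbrieJaffe1984to88.BIJ88SupportRegrouping312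

namespace Literature.MathematicalPhysics.QuantumFieldTheory.BalabanImbrieJaffe1984to88.BIJ88ObservableFactorization312

variable {ι : Type*} [DecidableEq ι] {P : Type*} [DecidableEq P] {Q : Type*} [DecidableEq Q] {σ : Type*} [DecidableEq σ]

/-! ## §1 Items, constraints, and the definition of `G_k` -/

section Defs

variable (supp : P → Finset ι) (suppQ : Q → Finset ι) (obs : Q → Finset σ) (loc : σ → Finset ι) (Rset : Finset σ)

/-- the supports of the items: a decorated polymer `X` fills `suppQ X`, a Mayer support set fills itself. [cite: BalabanImbrieJaffe1988, (5.14.5) p.312] -/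
def isuppO : Q ⊕ Finset ι → Finset ι := Sum.elim suppQ id

/-- the ADMISSIBLE DECORATED FAMILIES `{X_γ}`: pairwise non-overlapping (p. 309 *"{X_γ},{Y_δ} nonoverlapping"*), carrying every inserted observable
exactly once (p. 310 *"the corresponding subsets of H remain the same — no duplication"*; disjointness of the carried sets follows from the
covering convention). [cite: BalabanImbrieJaffe1988, (5.14.5) p.312] -/
def decFamilies (𝒬 : Finset Q) : Finset (Finset Q) :=
  𝒬.powerset.filter fun D => (∀ X ∈ D, ∀ X' ∈ D, X ≠ X' → Disjoint (suppQ X) (suppQ X')) ∧ D.biUnion obs = Rset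

/-- the nonempty supports of subfamilies of `Λ` (the possible Mayer support sets). [cite: BalabanImbrieJaffe1988, (5.14.5) p.312] -/
def suppSets (Λ : Finset P) : Finset (Finset ι) := (supports supp Λ).filter fun S => S.Nonempty

/-- the universe of items: decorated polymers of `𝒬` and nonempty supports of subfamilies of `Λ`. [cite: BalabanImbrieJaffe1988, (5.14.5) p.312] -/
def itemU (𝒬 : Finset Q) (Λ : Finset P) : Finset (Q ⊕ Finset ι) := 𝒬.disjSum (suppSets supp Λ)

/-- the inserted observables located inside a set of cubes `X′` (*"covers at least one X_{σ₁}"*). [cite: BalabanImbrieJaffe1988, (5.14.5) p.312] -/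
def obsIn (X' : Finset ι) : Finset σ := Rset.filter fun r => loc r ⊆ X'

/-- **the local constraint** on an overlap-connected set of items `K` (decorated polymers `K.toLeft`, support sets `K.toRight`): the decorated
polymers are pairwise non-overlapping, every support set overlaps one of them (p. 310 *"each Y_δ is connected directly or indirectly to some X_γ"*),
and the observables they carry are exactly the inserted observables located inside the support of `K` (p. 309 *"Each X_γ must cover … H_γ"*).
[cite: BalabanImbrieJaffe1988, (5.14.5) p.312] -/
def AdmLoc (K : Finset (Q ⊕ Finset ι)) : Prop :=
  (∀ X ∈ K.toLeft, ∀ X' ∈ K.toLeft, X ≠ X' → Disjoint (suppQ X) (suppQ X')) ∧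
    (∀ S ∈ K.toRight, ∃ X ∈ K.toLeft, ¬ Disjoint S (suppQ X)) ∧
      K.toLeft.biUnion obs = obsIn loc Rset (asupp (isuppO suppQ) K)

/-- `AdmLoc` is decidable. [cite: BalabanImbrieJaffe1988, (5.14.5) p.312] -/
instance instDecidablePredAdmLoc : DecidablePred (AdmLoc suppQ obs loc Rset) := fun K => by
  unfold AdmLoc; infer_instance

/-- **coverage**: every inserted observable has its support inside some member of the family `ρ` (*"each one covers at least one X_{σ₁}"* read
from the side of the observables: all of them are covered). [cite: BalabanImbrieJaffe1988, (5.14.5) p.312] -/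
def Cov (ρ : Finset (Finset ι)) : Prop := ∀ r ∈ Rset, ∃ X' ∈ ρ, loc r ⊆ X'

/-- `Cov` is decidable. [cite: BalabanImbrieJaffe1988, (5.14.5) p.312] -/
instance instDecidablePredCov : DecidablePred (Cov loc Rset) := fun ρ => by
  unfold Cov; infer_instance

/-- the weights of the items: `wQ` on decorated polymers, the Mayer factor `m(S) = e^{−Ψ(S)} − 1` on support sets. [cite: BalabanImbrieJaffe1988, (5.14.5) p.312] -/
def itemWeight (wQ : Q → ℂ) (inc : P → P → Prop) [DecidableRel inc] (w : P → ℂ) (Λ : Finset P) : Q ⊕ Finset ι → ℂ :=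
  Sum.elim wQ (mayer supp inc w Λ)

/-- **`G_k(X′)` DEFINED** (p. 312): the sum, over the overlap-CONNECTED sets `K` of decorated polymers of `𝒬` and Mayer support sets of `Λ` which
satisfy the local constraint and FILL exactly `X′` (`asupp K = X′`), of `Π_{X ∈ K.toLeft} wQ X · Π_{S ∈ K.toRight} m(S)` — the `aggWeight` of
`BIJ88SupportRegrouping312` for these data. [cite: BalabanImbrieJaffe1988, (5.14.5) p.312] -/
def Gk (𝒬 : Finset Q) (wQ : Q → ℂ) (inc : P → P → Prop) [DecidableRel inc] (w : P → ℂ) (Λ : Finset P) (X' : Finset ι) : ℂ :=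
  aggWeight (isuppO suppQ) (itemU supp 𝒬 Λ) (AdmLoc suppQ obs loc Rset) (itemWeight supp wQ inc w Λ) X'

end Defs

variable {supp : P → Finset ι} {suppQ : Q → Finset ι} {obs : Q → Finset σ} {loc : σ → Finset ι} {Rset : Finset σ}

omit [DecidableEq ι] [DecidableEq Q] in
/-- supports of items, by cases. [cite: BalabanImbrieJaffe1988, (5.14.5) p.312] -/
@[simp] theorem isuppO_inl (X : Q) : isuppO (ι := ι) suppQ (Sum.inl X) = suppQ X := rfl

omit [DecidableEq ι] [DecidableEq Q] in
/-- supports of items, by cases. [cite: BalabanImbrieJaffe1988, (5.14.5) p.312] -/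
@[simp] theorem isuppO_inr (S : Finset ι) : isuppO suppQ (Sum.inr S : Q ⊕ Finset ι) = S := rfl

/-- membership in `decFamilies`. [cite: BalabanImbrieJaffe1988, (5.14.5) p.312] -/
theorem mem_decFamilies {𝒬 D : Finset Q} :
    D ∈ decFamilies suppQ obs Rset 𝒬 ↔
      D ⊆ 𝒬 ∧ (∀ X ∈ D, ∀ X' ∈ D, X ≠ X' → Disjoint (suppQ X) (suppQ X')) ∧ D.biUnion obs = Rset := by
  unfold decFamilies; rw [mem_filter, mem_powerset]

omit [DecidableEq P] in
/-- membership in `suppSets`. [cite: BalabanImbrieJaffe1988, (5.14.5) p.312] -/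
theorem mem_suppSets {Λ : Finset P} {S : Finset ι} : S ∈ suppSets supp Λ ↔ S ∈ supports supp Λ ∧ S.Nonempty := by
  unfold suppSets; rw [mem_filter]

omit [DecidableEq P] [DecidableEq Q] in
/-- membership in `itemU`: decorated polymers. [cite: BalabanImbrieJaffe1988, (5.14.5) p.312] -/
theorem inl_mem_itemU {𝒬 : Finset Q} {Λ : Finset P} {X : Q} : (Sum.inl X : Q ⊕ Finset ι) ∈ itemU supp 𝒬 Λ ↔ X ∈ 𝒬 := by
  unfold itemU; exact inl_mem_disjSum

omit [DecidableEq P] [DecidableEq Q] in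
/-- membership in `itemU`: support sets. [cite: BalabanImbrieJaffe1988, (5.14.5) p.312] -/
theorem inr_mem_itemU {𝒬 : Finset Q} {Λ : Finset P} {S : Finset ι} : (Sum.inr S : Q ⊕ Finset ι) ∈ itemU supp 𝒬 Λ ↔ S ∈ suppSets supp Λ := by
  unfold itemU; exact inr_mem_disjSum

omit [DecidableEq σ] in
/-- membership in `obsIn`. [cite: BalabanImbrieJaffe1988, (5.14.5) p.312] -/
theorem mem_obsIn {X' : Finset ι} {r : σ} : r ∈ obsIn loc Rset X' ↔ r ∈ Rset ∧ loc r ⊆ X' := by unfold obsIn; rw [mem_filter]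

omit [DecidableEq Q] in
/-- the support of a decorated polymer of `K` lies inside the support of `K`. [cite: BalabanImbrieJaffe1988, (5.14.5) p.312] -/
theorem suppQ_subset_asupp {K : Finset (Q ⊕ Finset ι)} {X : Q} (hX : Sum.inl X ∈ K) : suppQ X ⊆ asupp (isuppO suppQ) K :=
  isupp_subset_asupp (isupp := isuppO suppQ) hX

omit [DecidableEq Q] in
/-- a support set of `K` lies inside the support of `K`. [cite: BalabanImbrieJaffe1988, (5.14.5) p.312] -/
theorem subset_asupp_of_inr {K : Finset (Q ⊕ Finset ι)} {S : Finset ι} (hS : Sum.inr S ∈ K) : S ⊆ asupp (isuppO suppQ) K :=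
  isupp_subset_asupp (isupp := isuppO suppQ) hS

omit [DecidableEq P] [DecidableEq Q] [DecidableEq σ] in
/-- under the covering convention every item of the universe has a nonempty support (a decorated polymer carries an observable, whose nonempty
support lies inside it). [cite: BalabanImbrieJaffe1988, (5.14.5) p.312] -/
theorem isuppO_nonempty {𝒬 : Finset Q} {Λ : Finset P} (hobs : ∀ X ∈ 𝒬, ∀ r ∈ obs X, r ∈ Rset ∧ loc r ⊆ suppQ X)
    (hobsne : ∀ X ∈ 𝒬, (obs X).Nonempty) (hloc : ∀ r ∈ Rset, (loc r).Nonempty) :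
    ∀ v ∈ itemU supp 𝒬 Λ, (isuppO suppQ v).Nonempty := by
  rintro (X | S) hv
  · have hX := inl_mem_itemU.1 hv
    obtain ⟨r, hr⟩ := hobsne X hX
    obtain ⟨hrR, hrX⟩ := hobs X hX r hr
    obtain ⟨i, hi⟩ := hloc r hrR
    exact ⟨i, hrX hi⟩
  · exact (mem_suppSets.1 (inr_mem_itemU.1 hv)).2

/-! ## §2 From pairs `(D, 𝒴)` to sets of items, and the locality of the constraints -/

/-- the global admissibility of a set of items `V` = of the pair `(V.toLeft, V.toRight)`: the decorated family is admissible and every support set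
overlaps it. [cite: BalabanImbrieJaffe1988, (5.14.5) p.312] -/
def GlobalAdm (suppQ : Q → Finset ι) (obs : Q → Finset σ) (Rset : Finset σ) (V : Finset (Q ⊕ Finset ι)) : Prop :=
  ((∀ X ∈ V.toLeft, ∀ X' ∈ V.toLeft, X ≠ X' → Disjoint (suppQ X) (suppQ X')) ∧ V.toLeft.biUnion obs = Rset) ∧
    ∀ S ∈ V.toRight, ∃ X ∈ V.toLeft, ¬ Disjoint S (suppQ X)

/-- `GlobalAdm` is decidable. [cite: BalabanImbrieJaffe1988, (5.14.5) p.312] -/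
instance instDecidablePredGlobalAdm : DecidablePred (GlobalAdm (ι := ι) suppQ obs Rset) := fun V => by
  unfold GlobalAdm; infer_instance

omit [DecidableEq Q] [DecidableEq σ] in
/-- a support set meets `dsupp D` iff it overlaps a member of `D`. [cite: BalabanImbrieJaffe1988, (5.14.5) p.312] -/
theorem not_disjoint_dsupp_iff {S : Finset ι} {D : Finset Q} : ¬ Disjoint S (dsupp suppQ D) ↔ ∃ X ∈ D, ¬ Disjoint S (suppQ X) := by
  rw [dsupp, disjoint_biUnion_right]; push Not; rfl

/-- **the step-2 sum as a sum over sets of items**: `Σ_{(D,𝒴): D ∈ decFamilies, 𝒴 ⊆ supports Λ, every S∈𝒴 meets dsupp D} Π wQ · Π m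
= Σ_{V ⊆ itemU, GlobalAdm V} Π_{v∈V} itemWeight v` (the pair `(D, 𝒴)` ↦ the set of items `D ⊔ 𝒴`). [cite: BalabanImbrieJaffe1988, (5.14.5) p.312] -/
theorem sum_pairs_eq_sum_items (𝒬 : Finset Q) (wQ : Q → ℂ) (inc : P → P → Prop) [DecidableRel inc] (w : P → ℂ) (Λ : Finset P) :
    ∑ p ∈ (decFamilies suppQ obs Rset 𝒬 ×ˢ (supports supp Λ).powerset) with (∀ S ∈ p.2, ¬ Disjoint S (dsupp suppQ p.1)),
        (∏ X ∈ p.1, wQ X) * ∏ S ∈ p.2, mayer supp inc w Λ S =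
      ∑ V ∈ (itemU supp 𝒬 Λ).powerset with GlobalAdm suppQ obs Rset V, ∏ v ∈ V, itemWeight supp wQ inc w Λ v := by
  refine sum_nbij' (fun p => p.1.disjSum p.2) (fun V => (V.toLeft, V.toRight)) ?_ ?_ ?_ ?_ ?_
  · -- into the admissible sets of items
    rintro ⟨D, 𝒴⟩ hp
    obtain ⟨hp, hmeet⟩ := mem_filter.1 hp
    obtain ⟨hD, h𝒴⟩ := mem_product.1 hp
    obtain ⟨hD𝒬, hpd, hcov⟩ := mem_decFamilies.1 hD
    simp only at hmeet
    refine mem_filter.2 ⟨mem_powerset.2 ?_, ?_⟩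
    · unfold itemU
      refine disjSum_subset.2 ⟨by rwa [toLeft_disjSum], fun S hS => ?_⟩
      rw [toRight_disjSum]
      exact mem_suppSets.2 ⟨mem_powerset.1 h𝒴 hS, nonempty_of_not_disjoint (hmeet S hS)⟩
    · refine ⟨⟨by rwa [toLeft_disjSum], by rwa [toLeft_disjSum]⟩, fun S hS => ?_⟩
      rw [toLeft_disjSum]
      rw [toRight_disjSum] at hS
      exact not_disjoint_dsupp_iff.1 (hmeet S hS)
  · -- back
    intro V hV
    obtain ⟨hV, hadm⟩ := mem_filter.1 hV
    obtain ⟨⟨hpd, hcov⟩, hmeet⟩ := hadm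
    have hV' := subset_disjSum.1 (by unfold itemU at hV; exact mem_powerset.1 hV)
    refine mem_filter.2 ⟨mem_product.2 ⟨mem_decFamilies.2 ⟨hV'.1, hpd, hcov⟩, mem_powerset.2 fun S hS => ?_⟩, fun S hS => ?_⟩
    · exact (mem_suppSets.1 (hV'.2 hS)).1
    · exact not_disjoint_dsupp_iff.2 (hmeet S hS)
  · rintro ⟨D, 𝒴⟩ _
    simp only [toLeft_disjSum, toRight_disjSum]
  · intro V _
    exact toLeft_disjSum_toRight
  · rintro ⟨D, 𝒴⟩ _
    rw [prod_disjSum]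
    rfl

variable {𝒬 : Finset Q} {Λ : Finset P}

/-- an item of `V` overlapping an item of the component `K` lies in `K`. [cite: BalabanImbrieJaffe1988, (5.14.5) p.312] -/
theorem mem_of_ov {V K : Finset (Q ⊕ Finset ι)} (hK : K ∈ rcomponents (Ov (isuppO suppQ)) V) {v w : Q ⊕ Finset ι} (hv : v ∈ K)
    (hw : w ∈ V) (hvw : Ov (isuppO suppQ) v w) : w ∈ K := by
  obtain ⟨p, hp, rfl⟩ := mem_rcomponents_iff.1 hK
  rw [← rcomponent_eq_of_mem ov_symm hv]
  exact mem_rcomponent.2 ⟨hw, Relation.ReflTransGen.single ⟨hvw, rcomponent_subset V p hv, hw⟩⟩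

omit [DecidableEq σ] in
/-- every item of `V` lies in some component. [cite: BalabanImbrieJaffe1988, (5.14.5) p.312] -/
theorem exists_rcomponent (suppQ : Q → Finset ι) {V : Finset (Q ⊕ Finset ι)} {v : Q ⊕ Finset ι} (hv : v ∈ V) :
    ∃ K ∈ rcomponents (Ov (isuppO suppQ)) V, v ∈ K := by
  have hv' : v ∈ (rcomponents (Ov (isuppO suppQ)) V).biUnion id := by rw [biUnion_rcomponents]; exact hv
  simpa only [mem_biUnion, id] using hv'

omit [DecidableEq P] in
/-- **locality of the constraints.** For a set of items `V` of the universe, under the covering convention (`hobs`) and nonempty observable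
supports (`hloc`): `V` is globally admissible (its decorated polymers pairwise non-overlapping and carrying exactly `Rset`, each of its support sets
overlapping one of its decorated polymers) iff EVERY OVERLAP-COMPONENT satisfies the local constraint `AdmLoc` AND the component supports cover
the observables (`Cov`). [cite: BalabanImbrieJaffe1988, (5.14.5) p.312] -/
theorem globalAdm_iff_local (hobs : ∀ X ∈ 𝒬, ∀ r ∈ obs X, r ∈ Rset ∧ loc r ⊆ suppQ X) (hloc : ∀ r ∈ Rset, (loc r).Nonempty)
    {V : Finset (Q ⊕ Finset ι)} (hV : V ⊆ itemU supp 𝒬 Λ) :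
    GlobalAdm suppQ obs Rset V ↔
      (∀ K ∈ rcomponents (Ov (isuppO suppQ)) V, AdmLoc suppQ obs loc Rset K) ∧
        Cov loc Rset ((rcomponents (Ov (isuppO suppQ)) V).image (asupp (isuppO suppQ))) := by
  set 𝒦 := rcomponents (Ov (isuppO suppQ)) V with h𝒦
  have hcomp : IsCompatible (GeomInc (Ov (isuppO suppQ))) 𝒦 := (rcomponents_props V).1
  have hsubV : ∀ K ∈ 𝒦, K ⊆ V := fun K hK => subset_of_mem_rcomponents hK
  have h𝒬 : ∀ X, Sum.inl X ∈ V → X ∈ 𝒬 := fun X hX => inl_mem_itemU.1 (hV hX)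
  -- an observable located in the supports of two components forces them equal
  have huniq : ∀ K ∈ 𝒦, ∀ K' ∈ 𝒦, ∀ r ∈ Rset, loc r ⊆ asupp (isuppO suppQ) K → loc r ⊆ asupp (isuppO suppQ) K' → K = K' := by
    intro K hK K' hK' r hr h1 h2
    by_contra hne
    obtain ⟨i, hi⟩ := hloc r hr
    exact disjoint_left.1 (disjoint_asupp_of_compatible hcomp hK hK' hne) (h1 hi) (h2 hi)
  constructor
  · rintro ⟨⟨hpd, hcov⟩, hmeet⟩
    refine ⟨fun K hK => ⟨fun X hX X' hX' hXX' => hpd X (toLeft_subset_toLeft (hsubV K hK) hX) X' (toLeft_subset_toLeft (hsubV K hK) hX') hXX',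
      fun S hS => ?_, ?_⟩, fun r hr => ?_⟩
    · -- every support set of `K` overlaps a decorated polymer of `K`
      have hSV : S ∈ V.toRight := toRight_subset_toRight (hsubV K hK) hS
      obtain ⟨X, hX, hSX⟩ := hmeet S hSV
      exact ⟨X, mem_toLeft.2 (mem_of_ov hK (mem_toRight.1 hS) (mem_toLeft.1 hX) hSX), hSX⟩
    · -- carried observables of `K` = inserted observables located in `asupp K`
      ext r
      rw [mem_biUnion, mem_obsIn]
      constructor
      · rintro ⟨X, hX, hr⟩
        have hXV : Sum.inl X ∈ V := hsubV K hK (mem_toLeft.1 hX)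
        obtain ⟨hrR, hrX⟩ := hobs X (h𝒬 X hXV) r hr
        exact ⟨hrR, hrX.trans (suppQ_subset_asupp (mem_toLeft.1 hX))⟩
      · rintro ⟨hrR, hrK⟩
        have hr' : r ∈ V.toLeft.biUnion obs := hcov.symm ▸ hrR
        obtain ⟨X, hX, hrX⟩ := mem_biUnion.1 hr'
        obtain ⟨K', hK', hXK'⟩ := exists_rcomponent suppQ (mem_toLeft.1 hX)
        have hsub : loc r ⊆ asupp (isuppO suppQ) K' := (hobs X (h𝒬 X (mem_toLeft.1 hX)) r hrX).2.trans (suppQ_subset_asupp hXK')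
        have hKK' : K = K' := huniq K hK K' hK' r hrR hrK hsub
        subst hKK'
        exact ⟨X, mem_toLeft.2 hXK', hrX⟩
    · -- coverage
      have hr' : r ∈ V.toLeft.biUnion obs := hcov.symm ▸ hr
      obtain ⟨X, hX, hrX⟩ := mem_biUnion.1 hr'
      obtain ⟨K', hK', hXK'⟩ := exists_rcomponent suppQ (mem_toLeft.1 hX)
      exact ⟨asupp (isuppO suppQ) K', mem_image_of_mem _ hK',
        (hobs X (h𝒬 X (mem_toLeft.1 hX)) r hrX).2.trans (suppQ_subset_asupp hXK')⟩
  · rintro ⟨hloc', hCov⟩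
    refine ⟨⟨fun X hX X' hX' hXX' => ?_, ?_⟩, fun S hS => ?_⟩
    · -- pairwise non-overlap: overlapping decorated polymers lie in one component
      obtain ⟨K, hK, hXK⟩ := exists_rcomponent suppQ (mem_toLeft.1 hX)
      by_contra hnd
      have hX'K : Sum.inl X' ∈ K := mem_of_ov hK hXK (mem_toLeft.1 hX') hnd
      exact hnd ((hloc' K hK).1 X (mem_toLeft.2 hXK) X' (mem_toLeft.2 hX'K) hXX')
    · -- the carried observables are exactly `Rset`
      ext r
      rw [mem_biUnion]
      constructor
      · rintro ⟨X, hX, hrX⟩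
        obtain ⟨K, hK, hXK⟩ := exists_rcomponent suppQ (mem_toLeft.1 hX)
        have : r ∈ K.toLeft.biUnion obs := mem_biUnion.2 ⟨X, mem_toLeft.2 hXK, hrX⟩
        rw [(hloc' K hK).2.2] at this
        exact (mem_obsIn.1 this).1
      · intro hr
        obtain ⟨X', hX', hrX'⟩ := hCov r hr
        obtain ⟨K, hK, rfl⟩ := mem_image.1 hX'
        have : r ∈ obsIn loc Rset (asupp (isuppO suppQ) K) := mem_obsIn.2 ⟨hr, hrX'⟩
        rw [← (hloc' K hK).2.2] at this
        obtain ⟨X, hX, hrX⟩ := mem_biUnion.1 this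
        exact ⟨X, toLeft_subset_toLeft (hsubV K hK) hX, hrX⟩
    · -- every support set overlaps a decorated polymer
      obtain ⟨K, hK, hSK⟩ := exists_rcomponent suppQ (mem_toRight.1 hS)
      obtain ⟨X, hX, hSX⟩ := (hloc' K hK).2.1 S (mem_toRight.2 hSK)
      exact ⟨X, toLeft_subset_toLeft (hsubV K hK) hX, hSX⟩

/-! ## §3 The second display of p. 312 -/

/-- **p. 312 [PDF 56], second display — DERIVED.** *"Without going into details, it is clear that the result can be written in the following form:
⟨Π_{σ₁} F^{m̄}_{k,loc}(X_{σ₁})⟩₁ = Σ_{{X_{r′}}} Π_{r′} G_k(X_{r′}) … The X_{r′} are disjoint, and each one covers at least one X_{σ₁}"* — in the form used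
for the remainder expectation ⟨Π_r F_{k,rem}(X_r)⟩₁ (all observables of `Rset` inserted): in a Kotecký–Preiss volume, with the printed incompatibility
*"X, Y overlap"*, under the covering convention and with nonempty observable supports,
`obsNumerator(decFamilies) / Z(Λ) = Σ_{ρ ∈ disjFamilies, Cov ρ} Π_{X′ ∈ ρ} G_k(X′)`: a finite sum over families `ρ = {X_{r′}}` of PAIRWISE DISJOINT
nonempty sets of cubes covering all observable supports, with the activities `G_k` of §1 (each `X_{r′}` with `G_k(X_{r′}) ≠ 0` covers an
observable support, `Gk_covers`). Derivation: step 1 `obsRatio_eq_sum_mul_exp` (KP ratio), step 2 `obsRatio_eq_sum_pairs` (supports + Mayer),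
`sum_pairs_eq_sum_items`, `globalAdm_iff_local`, step 3 `sum_admLoc_eq_sum_disjFamilies` (components). [cite: BalabanImbrieJaffe1988, (5.14.5) p.312] -/
theorem obsRatio_eq_sum_prod_Gk {inc : P → P → Prop} [DecidableRel inc] [Std.Refl inc] [Std.Symm inc] {incQ : Q → P → Prop}
    [∀ X Y, Decidable (incQ X Y)] (hincQ : ∀ X Y, incQ X Y ↔ ¬ Disjoint (suppQ X) (supp Y))
    (hobs : ∀ X ∈ 𝒬, ∀ r ∈ obs X, r ∈ Rset ∧ loc r ⊆ suppQ X) (hobsne : ∀ X ∈ 𝒬, (obs X).Nonempty) (hloc : ∀ r ∈ Rset, (loc r).Nonempty)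
    (wQ : Q → ℂ) {w : P → ℂ} {a : P → ℝ} (hKP : IsKPVolume inc w a Λ) :
    obsNumerator inc incQ (decFamilies suppQ obs Rset 𝒬) wQ w Λ / polymerPartitionFunction inc w Λ =
      ∑ ρ ∈ disjFamilies (asupp (isuppO suppQ) (itemU supp 𝒬 Λ)) with Cov loc Rset ρ,
        ∏ X' ∈ ρ, Gk supp suppQ obs loc Rset 𝒬 wQ inc w Λ X' := by
  rw [obsRatio_eq_sum_pairs hincQ _ wQ hKP, sum_pairs_eq_sum_items 𝒬 wQ inc w Λ]
  have hne := isuppO_nonempty (supp := supp) (Λ := Λ) hobs hobsne hloc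
  unfold Gk
  rw [← sum_admLoc_eq_sum_disjFamilies (AdmLoc := AdmLoc suppQ obs loc Rset) hne (itemWeight supp wQ inc w Λ) (Cov loc Rset)]
  refine sum_congr (filter_congr fun V hV => ?_) fun _ _ => rfl
  exact globalAdm_iff_local hobs hloc (mem_powerset.1 hV)

/-- *"each one covers at least one X_{σ₁}"*: an aggregate with non-zero activity `G_k(X′)` contains the support of an inserted observable (every
admissible connected set of items contains a decorated polymer, which carries an observable located inside the support).
[cite: BalabanImbrieJaffe1988, (5.14.5) p.312] -/
theorem Gk_covers {inc : P → P → Prop} [DecidableRel inc] (hobs : ∀ X ∈ 𝒬, ∀ r ∈ obs X, r ∈ Rset ∧ loc r ⊆ suppQ X)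
    (hobsne : ∀ X ∈ 𝒬, (obs X).Nonempty) (wQ : Q → ℂ) (w : P → ℂ) {X' : Finset ι}
    (hG : Gk supp suppQ obs loc Rset 𝒬 wQ inc w Λ X' ≠ 0) : ∃ r ∈ Rset, loc r ⊆ X' := by
  obtain ⟨K, hK, -⟩ := exists_ne_zero_of_sum_ne_zero hG
  obtain ⟨hKU, hKc, ⟨-, hmeet, -⟩, hKX⟩ := mem_aggFiber.1 hK
  -- `K` contains a decorated polymer
  obtain ⟨v, hv⟩ := hKc.1
  have hX : ∃ X, Sum.inl X ∈ K := by
    rcases v with X | S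
    · exact ⟨X, hv⟩
    · obtain ⟨X, hX, -⟩ := hmeet S (mem_toRight.2 hv)
      exact ⟨X, mem_toLeft.1 hX⟩
  obtain ⟨X, hXK⟩ := hX
  have hX𝒬 : X ∈ 𝒬 := inl_mem_itemU.1 (hKU hXK)
  obtain ⟨r, hr⟩ := hobsne X hX𝒬
  obtain ⟨hrR, hrX⟩ := hobs X hX𝒬 r hr
  exact ⟨r, hrR, hKX ▸ hrX.trans (suppQ_subset_asupp hXK)⟩

/-- the same display with the outer sum restricted to families each of whose members covers an observable support (the printed index set
*"{X_{r′}}: disjoint, each one covers at least one X_{σ₁}"*): the other families contribute zero. [cite: BalabanImbrieJaffe1988, (5.14.5) p.312] -/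
theorem obsRatio_eq_sum_covering_prod_Gk {inc : P → P → Prop} [DecidableRel inc] [Std.Refl inc] [Std.Symm inc] {incQ : Q → P → Prop}
    [∀ X Y, Decidable (incQ X Y)] (hincQ : ∀ X Y, incQ X Y ↔ ¬ Disjoint (suppQ X) (supp Y))
    (hobs : ∀ X ∈ 𝒬, ∀ r ∈ obs X, r ∈ Rset ∧ loc r ⊆ suppQ X) (hobsne : ∀ X ∈ 𝒬, (obs X).Nonempty) (hloc : ∀ r ∈ Rset, (loc r).Nonempty)
    (wQ : Q → ℂ) {w : P → ℂ} {a : P → ℝ} (hKP : IsKPVolume inc w a Λ) :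
    obsNumerator inc incQ (decFamilies suppQ obs Rset 𝒬) wQ w Λ / polymerPartitionFunction inc w Λ =
      ∑ ρ ∈ disjFamilies (asupp (isuppO suppQ) (itemU supp 𝒬 Λ)) with (Cov loc Rset ρ ∧ ∀ X' ∈ ρ, ∃ r ∈ Rset, loc r ⊆ X'),
        ∏ X' ∈ ρ, Gk supp suppQ obs loc Rset 𝒬 wQ inc w Λ X' := by
  rw [obsRatio_eq_sum_prod_Gk hincQ hobs hobsne hloc wQ hKP, ← filter_filter]
  symm
  refine sum_filter_of_ne fun ρ _ hρ X' hX' => ?_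
  by_contra hG
  push Not at hG
  have : Gk supp suppQ obs loc Rset 𝒬 wQ inc w Λ X' = 0 := by
    by_contra h
    obtain ⟨r, hr, hrX⟩ := Gk_covers hobs hobsne wQ w h
    exact hG r hr hrX
  exact hρ (prod_eq_zero hX' this)

end Literature.MathematicalPhysics.QuantumFieldTheory.BalabanImbrieJaffe1984to88.BIJ88ObservableFactorization312
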